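import Summits.Ventures.CertifiedManyBodySolver.Rows.HomTorusEnergyDensity
import Literature.MathematicalPhysics.QuantumLattice.MagneticHubbardTorusGauge
import HarnessLib

/-!
# Torus ceiling — Part VI: Peierls phases on the torus generated by hop vectors (twisted tori)

HONEST FRAMING: first certified bounds; not a superconductivity verdict; every number certified or
labelled float.
For an additive map `φ : ℤ^d →+ (ℤ/N)^{d'}` (Part I, `Rows/HomTorusModel.lean`) and bond phases
`A x i ∈ U(1)` on the hops `x → x + φ(eᵢ)`, the PEIERLS Hubbard Hamiltonian
`H_A = −t Σ_{x,i,σ} (A_{x,i} c†_{x+φeᵢ,σ} c_{x,σ} + h.c.) + U Σ n↑ n↓` on the fermionic torus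
`FermionTorus d' N`.  A UNIFORM field `A x i = κᵢ` is the twisted torus (twist `κᵢ^{Lᵢ}` through the
cycle of direction `i`; by the gauge covariance below it is unitarily equivalent, sector by sector,
to a one-seam twisted-boundary torus): e.g. the CRT rings `ℤ/15 ≅ 3 × 5`, `ℤ/12 ≅ 3 × 4` of Part V
with periodic/antiperiodic seams.  This file: the model, Hermiticity, `U(1) × U(1)` symmetry, gauge
covariance `W_g H_A W_gᴴ = H_{g⁻¹·A}`, translation covariance for translation-invariant `A`, and
`H_1 = homHubbard φ` for non-degenerate hops.  Pattern: `Literature/…/MagneticHubbardTorus*.lean`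
(square NN torus) transported to the hom carrier. [cite: Lieb1994, eq. (1)]
[cite: ShastrySutherland1990] [cite: FriedliVelenik2017, §3.1]
-/

noncomputable section

open Matrix Finset
open Literature.MathematicalPhysics.QuantumLattice
open Literature.MathematicalPhysics.QuantumFieldTheory hiding Site
open Literature.MathematicalPhysics.QuantumManyBody.StateRelaxation
open Literature.Probability.LatticeModels
open HubbardWave0
open scoped ComplexOrder ComplexConjugate

namespace Summit.Ventures.CertifiedManyBodySolver.Rows

section MagModel

variable {d d' N : ℕ} [NeZero N] (φ : Site d →+ TorusSite d' N)

/-- Elaborate torus identities with the order-derived `DecidableEq` (the convention of the tree's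
torus files `FockRelabel`, `FluxTorusSymmetries`, `TorusCeilingHom`). -/
local instance (priority := high) instDecidableEqFermionTorusHomMag : DecidableEq (FermionTorus d' N) :=
  LinearOrder.toDecidableEq

/-! ### §1. The Peierls Hamiltonian on the torus generated by `φ` -/

/-- **Peierls (magnetic) Hubbard Hamiltonian on the torus generated by `φ`**: bond phase `A x i` on
the hop `x → x + φ(eᵢ)`, its conjugate on the reverse hop, on-site repulsion `U`:
`H_A = −t Σ_{x,i,σ} (A_{x,i} c†_{x+φeᵢ,σ} c_{x,σ} + conj A_{x,i} c†_{x,σ} c_{x+φeᵢ,σ}) + U Σ_y n_{y↑} n_{y↓}`.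
Lieb, PRL 73 (1994) 2158, eq. (1) (`t_{xy} = |t_{xy}| e^{iφ(x,y)}`). [cite: Lieb1994, eq. (1)] -/
def homHubbardMag (A : TorusSite d' N → Fin d → Circle) (t U : ℝ) :
    Matrix (Finset (Orb (FermionTorus d' N))) (Finset (Orb (FermionTorus d' N))) ℂ :=
  -(t : ℂ) • (∑ x : TorusSite d' N, ∑ i : Fin d, ∑ σ : Fin 2,
      (((A x i : Circle) : ℂ) •
          (creation (orb (FermionTorus.ofTorusSite (x + φ (unitVec i))) σ) *
            annihilation (orb (FermionTorus.ofTorusSite x) σ)) +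
        conj ((A x i : Circle) : ℂ) •
          (creation (orb (FermionTorus.ofTorusSite x) σ) *
            annihilation (orb (FermionTorus.ofTorusSite (x + φ (unitVec i))) σ)))) +
    (U : ℂ) • ∑ y : FermionTorus d' N, numberOp y 0 * numberOp y 1

/-- `H_A` with the interaction re-indexed over torus sites. [cite: Lieb1994, eq. (1)] -/
theorem homHubbardMag_eq_sum_torusSite (A : TorusSite d' N → Fin d → Circle) (t U : ℝ) :
    homHubbardMag φ A t U =
      -(t : ℂ) • (∑ x : TorusSite d' N, ∑ i : Fin d, ∑ σ : Fin 2,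
        (((A x i : Circle) : ℂ) •
            (creation (orb (FermionTorus.ofTorusSite (x + φ (unitVec i))) σ) *
              annihilation (orb (FermionTorus.ofTorusSite x) σ)) +
          conj ((A x i : Circle) : ℂ) •
            (creation (orb (FermionTorus.ofTorusSite x) σ) *
              annihilation (orb (FermionTorus.ofTorusSite (x + φ (unitVec i))) σ)))) +
      (U : ℂ) • ∑ x : TorusSite d' N,
        numberOp (FermionTorus.ofTorusSite x) 0 * numberOp (FermionTorus.ofTorusSite x) 1 := by
  unfold homHubbardMag
  exact congrArg₂ (fun S T => -(t : ℂ) • S + (U : ℂ) • T) rfl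
    (Fintype.sum_equiv FermionTorus.equivTorusSite.symm
      (fun x : TorusSite d' N => numberOp (FermionTorus.ofTorusSite x) 0 * numberOp (FermionTorus.ofTorusSite x) 1)
      (fun y : FermionTorus d' N => numberOp y 0 * numberOp y 1) fun _ => rfl).symm

/-- `H_A` is Hermitian. [cite: Lieb1994, eq. (1)] -/
theorem homHubbardMag_isHermitian (A : TorusSite d' N → Fin d → Circle) (t U : ℝ) :
    (homHubbardMag φ A t U).IsHermitian := by
  unfold homHubbardMag Matrix.IsHermitian
  rw [conjTranspose_add, conjTranspose_smul, conjTranspose_smul, conjTranspose_sum_numberOp_mul_numberOp]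
  simp only [conjTranspose_sum, conjTranspose_add, conjTranspose_smul,
    conjTranspose_creation_mul_annihilation, Complex.star_def, map_neg, Complex.conj_ofReal,
    Complex.conj_conj]
  refine congrArg₂ (fun S T => -(t : ℂ) • S + (U : ℂ) • T) ?_ rfl
  exact Finset.sum_congr rfl fun x _ => Finset.sum_congr rfl fun i _ =>
    Finset.sum_congr rfl fun σ _ => add_comm _ _

/-- `H_A` conserves `N↑` and `N↓`. [cite: Lieb1994, eq. (1)] -/
theorem preservesSectors_homHubbardMag (A : TorusSite d' N → Fin d → Circle) (t U : ℝ) :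
    PreservesSectors (homHubbardMag φ A t U) := by
  unfold homHubbardMag
  refine PreservesSectors.add (PreservesSectors.smul (PreservesSectors.sum fun x _ =>
    PreservesSectors.sum fun i _ => PreservesSectors.sum fun σ _ =>
      PreservesSectors.add (PreservesSectors.smul (LiebThm1.preservesSectors_hopping _ _ σ) _)
        (PreservesSectors.smul (LiebThm1.preservesSectors_hopping _ _ σ) _)) _)
    (PreservesSectors.smul (PreservesSectors.sum fun y _ =>
      (LiebThm1.preservesSectors_numberOp y 0).mul (LiebThm1.preservesSectors_numberOp y 1)) _)

/-- `[H_A, N̂] = 0`. [cite: Lieb1994, eq. (1)] -/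
theorem homHubbardMag_commute_totalNumber (A : TorusSite d' N → Fin d → Circle) (t U : ℝ) :
    Commute (homHubbardMag φ A t U) (totalNumber : Matrix (Finset (Orb (FermionTorus d' N))) _ ℂ) := by
  rw [LiebThm1.totalNumber_eq_diagonal]
  exact (preservesSectors_homHubbardMag φ A t U).commute_diagonal fun a b => ((a + b : ℕ) : ℂ)

/-- `[H_A, S^z] = 0`. [cite: Lieb1994, eq. (1)] -/
theorem homHubbardMag_commute_spinZ (A : TorusSite d' N → Fin d → Circle) (t U : ℝ) :
    Commute (homHubbardMag φ A t U) (HubbardWave0.spinZ : Matrix (Finset (Orb (FermionTorus d' N))) _ ℂ) := by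
  rw [LiebThm1.spinZ_eq_diagonal]
  exact (preservesSectors_homHubbardMag φ A t U).commute_diagonal fun a b => (1 / 2 : ℂ) * ((a : ℂ) - (b : ℂ))

/-- `H_A` preserves every joint sector `(N, S^z)`. [cite: Lieb1994, eq. (1)] -/
theorem mulVec_homHubbardMag_mem_szSector (A : TorusSite d' N → Fin d → Circle) (t U : ℝ) {n : ℕ} {M : ℝ}
    {ψ : Fock (Orb (FermionTorus d' N))} (hψ : ψ ∈ szSector n M) :
    homHubbardMag φ A t U *ᵥ ψ ∈ szSector n M :=
  mulVec_mem_szSector_of_commute (homHubbardMag_commute_totalNumber φ A t U)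
    (homHubbardMag_commute_spinZ φ A t U) hψ

/-! ### §2. Gauge covariance -/

/-- **Gauge transformation of bond phases** on the torus generated by `φ`:
`(g·A) x i = g(x) A x i g(x + φeᵢ)⁻¹`. [cite: Lieb1994, eq. (1)] -/
def homGaugeTransform (g : TorusSite d' N → Circle) (A : TorusSite d' N → Fin d → Circle) :
    TorusSite d' N → Fin d → Circle :=
  fun x i => g x * A x i * (g (x + φ (unitVec i)))⁻¹

omit [NeZero N] in
/-- `g⁻¹ · (g · A) = A`. [cite: Lieb1994, eq. (1)] -/
theorem homGaugeTransform_inv_homGaugeTransform (g : TorusSite d' N → Circle)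
    (A : TorusSite d' N → Fin d → Circle) :
    homGaugeTransform φ g⁻¹ (homGaugeTransform φ g A) = A := by
  funext x i
  simp only [homGaugeTransform, Pi.inv_apply]
  group

/-- **Gauge covariance** `W_g H_A W_gᴴ = H_{g⁻¹·A}` (`W_g = phaseGauge (g ∘ toTorusSite)`).
Lieb, PRL 73 (1994) 2158 (before eq. (1)); Koma–Tasaki, PRL 68 (1992) 3248, eqs. (7)–(8).
[cite: Lieb1994, eq. (1)] -/
theorem phaseGauge_mul_homHubbardMag_mul_conjTranspose (g : TorusSite d' N → Circle)
    (A : TorusSite d' N → Fin d → Circle) (t U : ℝ) :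
    phaseGauge (fun u : FermionTorus d' N => g u.toTorusSite) * homHubbardMag φ A t U *
        (phaseGauge fun u : FermionTorus d' N => g u.toTorusSite)ᴴ =
      homHubbardMag φ (homGaugeTransform φ g⁻¹ A) t U := by
  have hnum : ∀ y : FermionTorus d' N,
      phaseGauge (fun u : FermionTorus d' N => g u.toTorusSite) * (numberOp y 0 * numberOp y 1) *
        (phaseGauge fun u : FermionTorus d' N => g u.toTorusSite)ᴴ = numberOp y 0 * numberOp y 1 := by
    intro y
    rw [phaseGauge_mul_mul_mul_conjTranspose, phaseGauge_mul_numberOp_mul_conjTranspose,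
      phaseGauge_mul_numberOp_mul_conjTranspose]
  unfold homHubbardMag
  rw [Matrix.mul_add, Matrix.add_mul, Matrix.mul_smul, Matrix.smul_mul, Matrix.mul_smul,
    Matrix.smul_mul, Finset.mul_sum, Finset.sum_mul, Finset.mul_sum, Finset.sum_mul]
  simp only [hnum]
  congr 2
  refine Finset.sum_congr rfl fun x _ => ?_
  rw [Finset.mul_sum, Finset.sum_mul]
  refine Finset.sum_congr rfl fun i _ => ?_
  rw [Finset.mul_sum, Finset.sum_mul]
  refine Finset.sum_congr rfl fun σ _ => ?_
  rw [Matrix.mul_add, Matrix.add_mul, Matrix.mul_smul, Matrix.smul_mul, Matrix.mul_smul,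
    Matrix.smul_mul, phaseGauge_mul_mul_mul_conjTranspose, phaseGauge_mul_creation_mul_conjTranspose,
    phaseGauge_mul_annihilation_mul_conjTranspose, smul_mul_smul, smul_smul,
    phaseGauge_mul_mul_mul_conjTranspose, phaseGauge_mul_creation_mul_conjTranspose,
    phaseGauge_mul_annihilation_mul_conjTranspose, smul_mul_smul, smul_smul]
  simp only [FermionTorus.toTorusSite_ofTorusSite, homGaugeTransform, Pi.inv_apply, inv_inv,
    Circle.coe_mul, Circle.coe_inv_eq_conj, map_mul, Complex.conj_conj]
  congr 2
  · ring
  · ring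

/-- **`H_{g·A} = W_gᴴ H_A W_g`.** [cite: Lieb1994, eq. (1)] -/
theorem homHubbardMag_homGaugeTransform (g : TorusSite d' N → Circle) (A : TorusSite d' N → Fin d → Circle)
    (t U : ℝ) :
    homHubbardMag φ (homGaugeTransform φ g A) t U =
      (phaseGauge fun u : FermionTorus d' N => g u.toTorusSite)ᴴ * homHubbardMag φ A t U *
        phaseGauge fun u : FermionTorus d' N => g u.toTorusSite := by
  have h := phaseGauge_mul_homHubbardMag_mul_conjTranspose φ g⁻¹ A t U
  rw [inv_inv] at h
  have h1 : (fun u : FermionTorus d' N => g u.toTorusSite)⁻¹ = fun u => g⁻¹ u.toTorusSite := rfl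
  have h2 : (fun u : FermionTorus d' N => g⁻¹ u.toTorusSite)⁻¹ = fun u => g u.toTorusSite := by
    funext u; simp only [Pi.inv_apply, inv_inv]
  rw [← h, phaseGauge_conjTranspose, phaseGauge_conjTranspose, h1, h2]

/-- **Gauge invariance of the sector energies**: `H_{g·A}` and `H_A` have the same lowest energy in
every joint sector `(N, S^z)`. Lieb 1994 ("the spectrum depends on the phases only through the
fluxes"). [cite: Lieb1994, eq. (1)] -/
theorem minEnergyOn_szSector_homGaugeTransform (g : TorusSite d' N → Circle)
    (A : TorusSite d' N → Fin d → Circle) (t U : ℝ) (n : ℕ) (M : ℝ) :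
    (homHubbardMag φ (homGaugeTransform φ g A) t U).minEnergyOn (szSector n M) =
      (homHubbardMag φ A t U).minEnergyOn (szSector n M) := by
  rw [homHubbardMag_homGaugeTransform]
  exact minEnergyOn_szSector_phaseGauge_conj _ _ n M

/-- A constant gauge transformation commutes with `H_A`. [cite: Lieb1994, eq. (1)] -/
theorem phaseGauge_const_mul_homHubbardMag (c : Circle) (A : TorusSite d' N → Fin d → Circle) (t U : ℝ) :
    phaseGauge (fun _ : FermionTorus d' N => c) * homHubbardMag φ A t U =
      homHubbardMag φ A t U * phaseGauge (fun _ : FermionTorus d' N => c) := by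
  have h := phaseGauge_mul_homHubbardMag_mul_conjTranspose φ (fun _ : TorusSite d' N => c) A t U
  have hg : homGaugeTransform φ (fun _ : TorusSite d' N => c)⁻¹ A = A := by
    funext x i
    simp only [homGaugeTransform, Pi.inv_apply, inv_inv]
    rw [mul_comm c⁻¹ (A x i), mul_assoc, inv_mul_cancel, mul_one]
  rw [hg] at h
  have h2 := congrArg (fun M => M * phaseGauge (fun _ : FermionTorus d' N => c)) h
  simp only at h2
  rw [Matrix.mul_assoc, conjTranspose_phaseGauge_mul_self, Matrix.mul_one] at h2
  exact h2

/-! ### §3. Translation covariance (translation-invariant phases) -/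

/-- **Translation covariance**: for a translation-invariant field (`A (x + v) = A x`) the torus
translation by `v` fixes `H_A`. [cite: FriedliVelenik2017, §3.1] -/
theorem relabel_translate_homHubbardMag (v : TorusSite d' N) (A : TorusSite d' N → Fin d → Circle)
    (hA : ∀ x i, A (x + v) i = A x i) (t U : ℝ) :
    relabel (Orb.translate v) (homHubbardMag φ A t U) = homHubbardMag φ A t U := by
  unfold homHubbardMag
  rw [relabel_add, relabel_smul, relabel_smul, relabel_sum, relabel_sum]
  refine congrArg₂ (fun S T => -(t : ℂ) • S + (U : ℂ) • T) ?_ ?_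
  · refine Fintype.sum_equiv (Equiv.addRight v) _ _ fun x => ?_
    simp only [Equiv.coe_addRight, relabel_sum, relabel_add, relabel_smul, relabel_mul,
      relabel_translate_creation, relabel_translate_annihilation, hA]
    refine Finset.sum_congr rfl fun i _ => ?_
    rw [add_right_comm x v (φ (unitVec i))]
  · refine Fintype.sum_equiv (FermionTorus.ofTorusEquiv (Equiv.addRight v)) _ _ fun y => ?_
    rw [relabel_mul, Orb.translate, relabel_mapEquiv_numberOp, relabel_mapEquiv_numberOp]

/-- The torus translations commute with `H_κ` for a UNIFORM field `κ`. [cite: FriedliVelenik2017, §3.1] -/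
theorem fockTranslate_mul_homHubbardMag_const (v : TorusSite d' N) (κ : Fin d → Circle) (t U : ℝ) :
    (fockTranslate v).val * homHubbardMag φ (fun _ => κ) t U =
      homHubbardMag φ (fun _ => κ) t U * (fockTranslate v).val :=
  (fockRelabel_commute_of_relabel_eq _
    (relabel_translate_homHubbardMag φ v (fun _ => κ) (fun _ _ => rfl) t U)).eq

/-! ### §4. Zero field: `H_1 = homHubbard φ` for non-degenerate hops -/

/-- `homHubbard φ` with all sums over torus sites and hop directions (non-degenerate hops).
[cite: FriedliVelenik2017, §3.1] -/
theorem homHubbard_eq_sum_torusSite (hd : Function.Injective (signedHop φ)) (t U : ℝ) :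
    homHubbard φ t U =
      -(t : ℂ) • (∑ v : TorusSite d' N, ∑ i : Fin d, ∑ σ : Fin 2,
          (creation (orb (FermionTorus.ofTorusSite v) σ) *
              annihilation (orb (FermionTorus.ofTorusSite (v + φ (unitVec i))) σ) +
            creation (orb (FermionTorus.ofTorusSite v) σ) *
              annihilation (orb (FermionTorus.ofTorusSite (v - φ (unitVec i))) σ))) +
        (U : ℂ) • ∑ v : TorusSite d' N,
          numberOp (FermionTorus.ofTorusSite v) 0 * numberOp (FermionTorus.ofTorusSite v) 1 := by
  rw [homHubbard, hamiltonian]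
  congr 1
  · congr 1
    rw [← Fintype.sum_equiv FermionTorus.equivTorusSite.symm
      (fun v : TorusSite d' N => ∑ i : Fin d, ∑ σ : Fin 2,
        (creation (orb (FermionTorus.ofTorusSite v) σ) *
            annihilation (orb (FermionTorus.ofTorusSite (v + φ (unitVec i))) σ) +
          creation (orb (FermionTorus.ofTorusSite v) σ) *
            annihilation (orb (FermionTorus.ofTorusSite (v - φ (unitVec i))) σ))) _ (fun v => ?_)]
    rw [← Fintype.sum_equiv FermionTorus.equivTorusSite.symm
      (fun w : TorusSite d' N => ∑ σ : Fin 2,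
        if (homTorusGraph φ).Adj (FermionTorus.equivTorusSite.symm v) (FermionTorus.ofTorusSite w) then
          creation (orb (FermionTorus.equivTorusSite.symm v) σ) *
            annihilation (orb (FermionTorus.ofTorusSite w) σ) else 0)
      _ (fun w => rfl)]
    have hv : (FermionTorus.equivTorusSite.symm v : FermionTorus d' N) = FermionTorus.ofTorusSite v := rfl
    simp_rw [hv]
    have hadj : ∀ w : TorusSite d' N, (homTorusGraph φ).Adj (FermionTorus.ofTorusSite v)
        (FermionTorus.ofTorusSite w) ↔ (homSiteGraph φ).Adj v w :=
      fun w => homTorusGraph_adj_ofTorusSite φ v w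
    have hite : ∀ w : TorusSite d' N, (∑ σ : Fin 2,
        if (homTorusGraph φ).Adj (FermionTorus.ofTorusSite v) (FermionTorus.ofTorusSite w) then
          creation (orb (FermionTorus.ofTorusSite v) σ) * annihilation (orb (FermionTorus.ofTorusSite w) σ)
        else 0) =
        if (homSiteGraph φ).Adj v w then ∑ σ : Fin 2,
          creation (orb (FermionTorus.ofTorusSite v) σ) * annihilation (orb (FermionTorus.ofTorusSite w) σ)
        else 0 := by
      intro w
      by_cases h : (homSiteGraph φ).Adj v w
      · rw [if_pos h]
        exact Finset.sum_congr rfl fun σ _ => by rw [if_pos ((hadj _).2 h)]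
      · rw [if_neg h]
        exact Finset.sum_eq_zero fun σ _ => by rw [if_neg (fun h' => h ((hadj _).1 h'))]
    simp_rw [hite]
    rw [sum_ite_homSiteGraph_adj φ hd v]
    simp only [Finset.sum_add_distrib]
  · congr 1
    exact (Fintype.sum_equiv FermionTorus.equivTorusSite.symm
      (fun v => numberOp (FermionTorus.ofTorusSite v) 0 * numberOp (FermionTorus.ofTorusSite v) 1)
      (fun x : FermionTorus d' N => numberOp x 0 * numberOp x 1) fun v => rfl).symm

/-- **Zero field**: for non-degenerate hops the Peierls Hamiltonian with all phases `1` is the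
Hubbard Hamiltonian of the torus generated by `φ`: `H_1 = homHubbard φ t U`. [cite: Lieb1994, eq. (1)] -/
theorem homHubbardMag_one_eq_homHubbard (hd : Function.Injective (signedHop φ)) (t U : ℝ) :
    homHubbardMag φ 1 t U = homHubbard φ t U := by
  rw [homHubbard_eq_sum_torusSite φ hd, homHubbardMag_eq_sum_torusSite]
  simp only [Pi.one_apply, Circle.coe_one, map_one, one_smul]
  refine congrArg₂ (fun S T => -(t : ℂ) • S + (U : ℂ) • T) ?_ rfl
  rw [Finset.sum_comm]
  conv_rhs => rw [Finset.sum_comm]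
  refine Finset.sum_congr rfl fun i _ => ?_
  simp only [Finset.sum_add_distrib]
  rw [add_comm]
  exact congrArg₂ (· + ·) rfl (TorusSite.sum_sub_shift (φ (unitVec i)) (fun a b => ∑ σ : Fin 2,
    creation (orb (FermionTorus.ofTorusSite a) σ) * annihilation (orb (FermionTorus.ofTorusSite b) σ))).symm

end MagModel

end Summit.Ventures.CertifiedManyBodySolver.Rows

end
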